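import Literature.MathematicalPhysics.KineticTheory.HardSphereCampbellAssembly
import Literature.Analysis.FluidPDE.HardSphereTorusMeasure
import HarnessLib

/-!
# Campbell identity for hard spheres: contacts of the other pairs are flux-null

Topic `Literature/MathematicalPhysics/KineticTheory`. An input of the discharge of the named fact
`HardSphereCampbellFormula` (`Literature.MathematicalPhysics.KineticTheory.HardSphereCollisionCampbell`:
the stationary collision-rate / special-flow identity of Cercignani–Illner–Pulvirenti 1994, App. 4.A —
the Liouville mean of a marked collision sum over the window `(0, τ]` is `τ ×` the outgoing contact
flux of the mark).

On the flux side of that identity the mark is read on the contact configuration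
`contactInsert ε a b ω z` of the ordered pair `(a, b)` (particle `a` placed at `x_b + εω`, all other
data kept), integrated against `dz ⊗ dω` (Liouville measure times the surface measure of the unit
sphere), and the hard-core constraint is the indicator of the hard-sphere domain
`D_ε = {all pairs at distance ≥ ε}`. The first-collision lower bound of the discharge produces instead
the indicator of `{all OTHER pairs at distance > ε}` (a limit of the "others far" conditions of
Gallagher–Saint-Raymond–Texier 2013, §4.1–4.3); the two indicators differ exactly on the event
"some pair `{k, l} ≠ {a, b}` of the contact configuration is at minimal-image distance EXACTLY `ε`",
i.e. on the multiple-contact part of the boundary of `D_ε`, which carries no `σ`-mass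
(CIP 1994 App. 4.A: `dσ` lives on the smooth part `⋃ Σᵢⱼ` of the boundary; GST 2013 §4.1: the
boundary of `D_ε` is Lebesgue-null).

This file proves that this event is null for the flux measure (`pairFlux_otherContact_null`). For a
fixed direction `ω` and a fixed other pair `{k, l} ≠ {a, b}`, `k ≠ l`, one vertex `c ∈ {k, l}` lies
outside `{a, b}` (`exists_mem_not_mem_of_pair_ne`), so the data of particle `c` are a free coordinate
of `z` commuting with the contact insertion (`campbell_contactInsert_update`), and in that coordinate
the event reads "`x_c` lies on the minimal-image sphere of radius `ε ≠ 0` around the position of the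
other vertex in the contact configuration" — a Haar-null sphere (`Torus.volume_euclidDist_eq`), whence
a Liouville-null set by Fubini one particle at a time (`volume_eq_zero_of_sections`,
`campbell_volume_contactInsert_otherPair_null`); a finite union over the pairs and Tonelli in `(z, ω)`
conclude. Only `ε ≠ 0` is used; for `N ≤ 2` the event is empty.

## References

* [CIP1994] C. Cercignani, R. Illner, M. Pulvirenti, *The Mathematical Theory of Dilute Gases*,
  Applied Math. Sciences 106, Springer (1994), App. 4.A pp. 107–111 (special flow representation;
  the measure `dσ` on the contact hypersurfaces `Σᵢⱼ`).
* [GST2013] I. Gallagher, L. Saint-Raymond, B. Texier, *From Newton to Boltzmann*, EMS (2013),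
  §4.1 (the boundary of the hard-sphere domain is Lebesgue-null), Lemma 4.1.2.
-/

open MeasureTheory Set Function Filter Metric
open scoped ENNReal NNReal RealInnerProductSpace

namespace Literature.MathematicalPhysics.KineticTheory

open Literature.Analysis.FluidPDE

noncomputable section

variable {d : Type*} [Fintype d] {N : ℕ} {ε : ℝ}

/-! ### The contact insertion and the coordinates of a third particle -/

omit [Fintype d] in
/-- The contact insertion of the pair `(a, b)` commutes with replacing the data of a third particle
`c ∉ {a, b}`. [folklore] -/
theorem campbell_contactInsert_update {a b c : Fin N} (hca : c ≠ a) (hcb : c ≠ b) (ε : ℝ)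
    (ω : EuclideanSpace ℝ d) (z : Config N d (UnitAddTorus d))
    (y : UnitAddTorus d × EuclideanSpace ℝ d) :
    contactInsert ε a b ω (update z c y) = update (contactInsert ε a b ω z) c y := by
  unfold contactInsert
  rw [update_of_ne (Ne.symm hcb), update_of_ne (Ne.symm hca), update_comm hca]

omit [Fintype d] in
/-- For a fixed direction, the contact insertion is a measurable self-map of the phase space. [folklore] -/
theorem campbell_measurable_contactInsert (ε : ℝ) (a b : Fin N) (ω : EuclideanSpace ℝ d) :
    Measurable (contactInsert (N := N) ε a b ω) := by
  unfold contactInsert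
  refine measurable_update'.comp (measurable_id.prodMk ?_)
  exact ((measurable_pi_apply b).fst.add measurable_const).prodMk (measurable_pi_apply a).snd

/-! ### Null sets -/

/-- In one-particle data `(x, v) ∈ T^d × ℝ^d`, a minimal-image sphere condition of radius `ε ≠ 0` on
the position is `vol`-null (a Haar-null sphere times `ℝ^d`). [folklore] -/
theorem campbell_volume_setOf_euclidDist_fst_eq (hε : ε ≠ 0) (q : UnitAddTorus d) :
    volume {y : UnitAddTorus d × EuclideanSpace ℝ d | Torus.euclidDist y.1 q = ε} = 0 := by
  have h : {y : UnitAddTorus d × EuclideanSpace ℝ d | Torus.euclidDist y.1 q = ε} =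
      {x : UnitAddTorus d | Torus.euclidDist x q = ε} ×ˢ (univ : Set (EuclideanSpace ℝ d)) := by
    ext y
    simp only [mem_setOf_eq, mem_prod, mem_univ, and_true]
  rw [h, Measure.volume_eq_prod, Measure.prod_prod, Torus.volume_euclidDist_eq hε, zero_mul]

/-- The same with the centre written first. [folklore] -/
theorem campbell_volume_setOf_euclidDist_fst_eq' (hε : ε ≠ 0) (q : UnitAddTorus d) :
    volume {y : UnitAddTorus d × EuclideanSpace ℝ d | Torus.euclidDist q y.1 = ε} = 0 := by
  simp_rw [Torus.euclidDist_comm q]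
  exact campbell_volume_setOf_euclidDist_fst_eq hε q

/-- **One other pair in contact is Liouville-null, uniformly in the direction.** For `ε ≠ 0`, a fixed
`ω ∈ ℝ^d` and an unordered pair `{k, l} ≠ {a, b}` (`k ≠ l`), the configurations `z` whose
`(a, b)`-contact configuration `contactInsert ε a b ω z` has particles `k` and `l` at minimal-image
distance exactly `ε` form a `vol`-null set: a vertex `c ∈ {k, l}` outside `{a, b}` is a free particle
of the contact configuration, and in its position the condition is a sphere of radius `ε`
(GST 2013 §4.1, the boundary of `D_ε` is null; here read through the contact parametrisation of
CIP 1994 App. 4.A). [folklore] -/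
theorem campbell_volume_contactInsert_otherPair_null (hε : ε ≠ 0) {a b k l : Fin N} (hkl : k ≠ l)
    (hne : ({k, l} : Finset (Fin N)) ≠ {a, b}) (ω : EuclideanSpace ℝ d) :
    volume {z : Config N d (UnitAddTorus d) |
      ‖(Torus.geometry d).sepVec (contactInsert ε a b ω z k).1 (contactInsert ε a b ω z l).1‖ = ε} = 0 := by
  obtain ⟨c, e, hce, hca, hcb⟩ := exists_mem_not_mem_of_pair_ne hkl hne
  have hc : c = k ∨ c = l := by
    have h : c ∈ ({k, l} : Finset (Fin N)) := hce ▸ Finset.mem_insert_self c {e}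
    simpa only [Finset.mem_insert, Finset.mem_singleton] using h
  have hmeas : MeasurableSet {z : Config N d (UnitAddTorus d) |
      ‖(Torus.geometry d).sepVec (contactInsert ε a b ω z k).1 (contactInsert ε a b ω z l).1‖ = ε} :=
    measurableSet_eq_fun ((Torus.measurable_geometry_sepVec.comp
      ((measurable_pi_apply k).fst.prodMk (measurable_pi_apply l).fst)).comp
        (campbell_measurable_contactInsert ε a b ω)).norm measurable_const
  refine volume_eq_zero_of_sections hmeas c fun z => ?_
  rcases hc with rfl | rfl
  · simp only [mem_setOf_eq, campbell_contactInsert_update hca hcb, update_self,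
      update_of_ne (Ne.symm hkl), Torus.norm_geometry_sepVec]
    exact campbell_volume_setOf_euclidDist_fst_eq hε _
  · simp only [mem_setOf_eq, campbell_contactInsert_update hca hcb, update_self, update_of_ne hkl,
      Torus.norm_geometry_sepVec]
    exact campbell_volume_setOf_euclidDist_fst_eq' hε _

/-- **Some other pair in contact is Liouville-null, uniformly in the direction**: for `ε ≠ 0` and a
fixed `ω`, the configurations whose `(a, b)`-contact configuration has SOME pair `{k, l} ≠ {a, b}`
(`k ≠ l`) at minimal-image distance exactly `ε` form a `vol`-null set (a finite union of the previous
null sets; empty for `N ≤ 2`). [folklore] -/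
theorem campbell_volume_preimage_otherContact_null (hε : ε ≠ 0) (a b : Fin N)
    (ω : EuclideanSpace ℝ d) :
    volume ((contactInsert ε a b ω) ⁻¹' {w : Config N d (UnitAddTorus d) | ∃ k l : Fin N, k ≠ l ∧
      ({k, l} : Finset (Fin N)) ≠ {a, b} ∧ ‖(Torus.geometry d).sepVec (w k).1 (w l).1‖ = ε}) = 0 := by
  simp only [setOf_exists, preimage_iUnion, preimage_setOf_eq]
  refine measure_iUnion_null fun k => measure_iUnion_null fun l => ?_
  by_cases hkl : k = l
  · exact measure_mono_null (fun z hz => (hz.1 hkl).elim) measure_empty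
  by_cases hne : ({k, l} : Finset (Fin N)) = {a, b}
  · exact measure_mono_null (fun z hz => (hz.2.1 hne).elim) measure_empty
  · exact measure_mono_null (fun z hz => hz.2.2)
      (campbell_volume_contactInsert_otherPair_null hε hkl hne ω)

/-- For `ε ≠ 0` and a fixed direction `ω`, the Liouville integral of the indicator of the event
"some other pair of the `(a, b)`-contact configuration is at distance exactly `ε`" vanishes. [folklore] -/
theorem campbell_lintegral_otherContact_indicator (hε : ε ≠ 0) (a b : Fin N)
    (ω : EuclideanSpace ℝ d) :
    ∫⁻ z : Config N d (UnitAddTorus d),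
      {w : Config N d (UnitAddTorus d) | ∃ k l : Fin N, k ≠ l ∧ ({k, l} : Finset (Fin N)) ≠ {a, b} ∧
          ‖(Torus.geometry d).sepVec (w k).1 (w l).1‖ = ε}.indicator (fun _ => (1 : ℝ≥0∞))
        (contactInsert ε a b ω z) = 0 := by
  -- the integrand is the indicator of the preimage of the event under the contact insertion
  have key : ∀ {S : Set (Config N d (UnitAddTorus d))}, volume ((contactInsert ε a b ω) ⁻¹' S) = 0 →
      ∫⁻ z : Config N d (UnitAddTorus d), S.indicator (fun _ => (1 : ℝ≥0∞))
        (contactInsert ε a b ω z) = 0 := by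
    intro S hS
    refine le_antisymm
      ((lintegral_indicator_const_le ((contactInsert ε a b ω) ⁻¹' S) 1).trans ?_) zero_le
    rw [hS, mul_zero]
  exact key (campbell_volume_preimage_otherContact_null hε a b ω)

/-! ### The flux-null statement -/

/-- **In the contact configuration of a pair, almost surely no other pair is in contact.** For
`0 < ε < 1/2` and an ordered pair `a ≠ b` of `N` hard spheres of diameter `ε` on `T^d`, the event
"in the contact configuration `contactInsert ε a b ω z` of the pair `(a, b)` some OTHER pair
`{k, l} ≠ {a, b}` is at minimal-image distance exactly `ε`" is null for the flux measure `dz ⊗ dω`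
(Liouville measure times the surface measure of the unit sphere): the difference between the
hard-core indicator `1_{D_ε}` (all pairs at distance `≥ ε`) and the indicator "all other pairs at
distance `> ε`" of the contact configuration is invisible in the outgoing collision flux of the
Campbell / special-flow identity (CIP 1994 App. 4.A: the measure `dσ = ∏_{k ≠ i} dx_k ∏ dξ_k dγᵢⱼ
|nᵢⱼ·(ξᵢ − ξⱼ)|` on `Σᵢⱼ` gives no mass to configurations with a second pair in contact). Proof:
Tonelli, and for each fixed `ω` the `z`-event is Liouville-null
(`campbell_volume_preimage_otherContact_null`); only `ε ≠ 0` is used, the hypotheses `ε < 1/2` and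
`a ≠ b` (under which `contactInsert` is a genuine contact configuration, `norm_sepVec_contactInsert`)
are those of the flux functional. [cite: CIP1994, App. 4.A pp. 107–111] -/
theorem pairFlux_otherContact_null (hε0 : 0 < ε) (hε : ε < 1 / 2) {a b : Fin N} (hab : a ≠ b) :
    ∫⁻ z : Config N d (UnitAddTorus d), ∫⁻ ω : Metric.sphere (0 : EuclideanSpace ℝ d) 1,
        {w : Config N d (UnitAddTorus d) | ∃ k l : Fin N, k ≠ l ∧ ({k, l} : Finset (Fin N)) ≠ {a, b} ∧
            ‖(Torus.geometry d).sepVec (w k).1 (w l).1‖ = ε}.indicator (fun _ => (1 : ℝ≥0∞))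
          (contactInsert ε a b (ω : EuclideanSpace ℝ d) z)
        ∂(volume : Measure (EuclideanSpace ℝ d)).toSphere = 0 := by
  -- only `ε ≠ 0` matters: the contact hypotheses `ε < 1 / 2`, `a ≠ b` are not used below
  obtain ⟨-, -⟩ : ε < 1 / 2 ∧ a ≠ b := ⟨hε, hab⟩
  have hS : MeasurableSet {w : Config N d (UnitAddTorus d) | ∃ k l : Fin N, k ≠ l ∧
      ({k, l} : Finset (Fin N)) ≠ {a, b} ∧ ‖(Torus.geometry d).sepVec (w k).1 (w l).1‖ = ε} :=
    measurableSet_setOf.2 <| Measurable.exists fun k => Measurable.exists fun l =>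
      Measurable.and measurable_const <| Measurable.and measurable_const <|
        ((Torus.measurable_geometry_sepVec.comp
          ((measurable_pi_apply k).fst.prodMk (measurable_pi_apply l).fst)).norm).eq_const ε
  have hF : AEMeasurable (uncurry fun (z : Config N d (UnitAddTorus d))
      (ω : Metric.sphere (0 : EuclideanSpace ℝ d) 1) =>
        {w : Config N d (UnitAddTorus d) | ∃ k l : Fin N, k ≠ l ∧ ({k, l} : Finset (Fin N)) ≠ {a, b} ∧
            ‖(Torus.geometry d).sepVec (w k).1 (w l).1‖ = ε}.indicator (fun _ => (1 : ℝ≥0∞))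
          (contactInsert ε a b (ω : EuclideanSpace ℝ d) z))
      ((volume : Measure (Config N d (UnitAddTorus d))).prod
        (volume : Measure (EuclideanSpace ℝ d)).toSphere) :=
    ((measurable_const.indicator hS).comp (measurable_contactInsert_prod ε a b)).aemeasurable
  haveI : SigmaFinite (volume : Measure (UnitAddTorus d × EuclideanSpace ℝ d)) := inferInstance
  haveI : SigmaFinite (volume : Measure (Config N d (UnitAddTorus d))) := inferInstance
  haveI : SFinite ((volume : Measure (EuclideanSpace ℝ d)).toSphere) := inferInstance
  rw [lintegral_lintegral_swap hF]
  refine (lintegral_congr fun ω => ?_).trans lintegral_zero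
  exact campbell_lintegral_otherContact_indicator hε0.ne' a b _

end

end Literature.MathematicalPhysics.KineticTheory
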